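import Mathlib
import Summits.CriticalPhenomena.SAWScalingLimit.Theorems.ObservableToSLE.Negative.HypothesisSilence

/-!
# Silence of the REPAIRED hypothesis at the root (crux `ObservableToSLE`, stmt-CriticalPhenomena-10472;
obstruction W2, root side)

Negative lemma (refuter, cdisprove gen 3).  Since rev 4 of the route files (2026-08-16) the crux's
antecedent `HexObservableLimit` (item stmt-14003, = `HexObservableLimitR` of the sibling routes)
requires the flat half-plane premise `D.carrier ∩ ball (D.pt i) ρ = {im z > im (D.pt i)} ∩ ball …`
at BOTH marked points `i = 0, 1`.  `Negative.HypothesisSilence.flat_premise_false_on_unitDisc`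
showed the premise fails at `pt 1 = -1` of the unit disc; here the same at the ROOT `pt 0 = 1`
(theorem `flat_premise_false_on_unitDisc_root`, real witness `1 - min(ρ,1)/2`), and the packaged form
`flat_premise_false_on_unitDisc_both`: for every radius the two-point premise of the repaired
hypothesis fails on the disc at each marked point — the hypothesis is silent on every Dobrushin
domain one of whose marked points is not on a horizontal floor with the domain above, while the
conclusion of the crux quantifies over all of them.
-/

noncomputable section

open Literature.Probability.RandomPlanarGeometry MeasureTheory Filter Topology Set

namespace Summit.CriticalPhenomena.SAWScalingLimit.Theorems.ObservableToSLE.Negative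

/-- SILENCE AT THE ROOT (W2, rev 4): the flat-at-`pt 0` premise of the repaired `HexObservableLimit`
FAILS for the unit disc and every `ρ > 0` (witness `1 - min(ρ,1)/2`). [folklore] -/
theorem flat_premise_false_on_unitDisc_root (ρ : ℝ) (hρ : 0 < ρ) :
    DobrushinDomain.unitDisc.carrier ∩ Metric.ball (DobrushinDomain.unitDisc.pt 0) ρ ≠
      {z : ℂ | (DobrushinDomain.unitDisc.pt 0).im < z.im} ∩
        Metric.ball (DobrushinDomain.unitDisc.pt 0) ρ := by
  have hpt : DobrushinDomain.unitDisc.pt 0 = 1 := by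
    simp [MarkedDomain.pt, DobrushinDomain.unitDisc, JordanDomain.unitDisc, circleMap]
  rw [hpt]
  intro h
  set t : ℝ := min (ρ / 2) (1 / 2) with htdef
  have ht0 : 0 < t := lt_min (by linarith) (by norm_num)
  have htρ : t < ρ := (min_le_left _ _).trans_lt (by linarith)
  have ht1 : t ≤ 1 / 2 := min_le_right _ _
  have hz : (((1 - t : ℝ)) : ℂ) ∈ DobrushinDomain.unitDisc.carrier ∩ Metric.ball (1 : ℂ) ρ := by
    constructor
    · show ((1 - t : ℝ) : ℂ) ∈ Metric.ball (0 : ℂ) 1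
      rw [Metric.mem_ball, dist_zero_right, Complex.norm_real, Real.norm_eq_abs, abs_lt]
      constructor <;> linarith
    · rw [Metric.mem_ball, dist_eq_norm, show ((1 - t : ℝ) : ℂ) - 1 = ((-t : ℝ) : ℂ) by push_cast; ring,
        Complex.norm_real, Real.norm_eq_abs, abs_neg, abs_of_pos ht0]
      exact htρ
  rw [h] at hz
  have := hz.1
  simp at this

/-- The two-point flat premise of the repaired hypothesis (`∀ i : Fin 2, …`) fails on the unit disc
at EACH marked point, for every radius. [folklore] -/
theorem flat_premise_false_on_unitDisc_both (ρ : ℝ) (hρ : 0 < ρ) (i : Fin 2) :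
    DobrushinDomain.unitDisc.carrier ∩ Metric.ball (DobrushinDomain.unitDisc.pt i) ρ ≠
      {z : ℂ | (DobrushinDomain.unitDisc.pt i).im < z.im} ∩
        Metric.ball (DobrushinDomain.unitDisc.pt i) ρ := by
  fin_cases i
  · exact flat_premise_false_on_unitDisc_root ρ hρ
  · exact flat_premise_false_on_unitDisc ρ hρ

end Summit.CriticalPhenomena.SAWScalingLimit.Theorems.ObservableToSLE.Negative
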